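import Summits.CriticalPhenomena.PercolationContinuityZ3.Theorems.PercNearOneGluingNoHeavyLowerTailSahiConvolution
import Summits.CriticalPhenomena.PercolationContinuityZ3.Theorems.PercNearOneGluingNoHeavyLowerTailSahiMixtureHereditaryFour
import Summits.CriticalPhenomena.PercolationContinuityZ3.Theorems.PercNearOneGluingNoHeavyLowerTailSahiMixtureAnd
import Summits.CriticalPhenomena.PercolationContinuityZ3.Theorems.SahiMasterFamilyTensorisation
import Literature.Combinatorics.Sahi2008.FKGCumulation

/-!
# The HEREDITARY class `𝒦`: all orders for the intersection-closed family — stable under independent intersections (every `n`),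
# contains the log-supermodular laws (Sahi–Blinovsky), excludes the mixture counterexample; the HEREDITARY MIXTURE CONJECTURE typed

Support file of the one-cut programme (crux `NoHeavyLowerTail`, stmt-CriticalPhenomena-4575; cell `prim-masterthm`, seat P3, gen 6;
`run/shared/lean/prim/prim-masterthm/prim-masterthm-p3/HIERARCHY.md` §12(k), §13).  Vocabulary: `…SahiMixtureLaw` (`AllOrders`, `coinWeight`, `orCoin`,
`BernsteinPos`), `…SahiConvolution` (`prodWeight`, `interEv`, the refuted `InterClosure`), seat P4's `SahiTotalCumulance.sahiE_prod_tensor_eq`.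

THE CLASS.  `HereditaryAllOrders μ A` (`𝒦`): the INTERSECTION-CLOSED family generated by the events `A_0,…,A_{n−1}` — all `A_K = ⋂_{i∈K} A_i`,
`K ⊆ [n]` (`A_∅ = Ω`) — is Sahi-nonnegative at every order (every multiset of members).  In pattern-law terms: the principal up-sets `[C ⊇ K]` of the
law of `C = {i : ω ∈ A_i}`, i.e. Sahi–Blinovsky's MONOMIAL class; so `𝒦 ∋` every log-supermodular law (`hereditaryAllOrders_of_isFKGMeasure`, from the
tree's `sahi2008_thm2_fkg` [Sahi2008, Thm. 2; Blinovsky2013]) and `𝒦 ⊆ K` (`HereditaryAllOrders.allOrders`), strictly: ttrl cp-mix's mixture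
counterexample (`…SahiMixtureFourRefutation.cex4Weight`, all eleven square-free rows `> 0`) is NOT in `𝒦_4` — its derived cubic row
`E_3(A_0∩A_1, A_2, A_3) = −27/2450` (`not_hereditaryAllOrders_cex4`).

THEOREMS (every `n`, any finite probability spaces, no FKG hypothesis anywhere):
* **`sahiE_interEv_nonneg` / `allOrders_interEv_of_hereditary` — INTERSECTION STABILITY `K ∗_∩ 𝒦 ⊆ K`.**  If `(V_i)` is all-orders positive under `μ`
  and `(W_i)` is HEREDITARILY all-orders positive under `ν`, then the member-wise intersections `(V_i × W_i)` are all-orders positive under `μ ⊗ ν`.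
  (The tree's `not_interClosure`: with `W` merely in `K` this is false already for three members — heredity of ONE factor is exactly what is needed.)
  Proof: `1_{V×W} = 1_V ⊗ 1_W`; P4's law of total cumulance in tensor form writes `E_m` as `Σ_π [Π_B E^μ_{|B|}(V_B)]·E^ν_{|π|}(⋂_{j∈B} W_j : B ∈ π)`,
  and the second factor is a row of the ∩-closed family of `W`.  All signs plus.
* **`hereditary_interEv` — `𝒦 ∗_∩ 𝒦 ⊆ 𝒦`**: the hereditary class is closed under member-wise intersection of independent families (intersections of
  products are products of intersections).
* `bernsteinPos_four_orCoin_two_of_hereditaryAllOrders` — on `𝒦_4` the OR-mixture cell that kills the law-level mixture conjecture (`(n,|F|) = (4,2)`) is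
  Bernstein-positive (`…SahiMixtureHereditaryFour`).
CONJECTURE (typed, `@[conjecture] HereditaryMixturePositivity`, H-MIX; this seat gen 5/6): `𝒦` is preserved, Bernstein-positively in the bias, under
OR-ing an independent coin into any sub-collection — the ∩-closed family of the mixed events being `B_K = A_K ∪ (H ∩ A_{K∖F})`.  H-MIX ⇒ all-orders Sahi
positivity of every finite Boolean model (OR(∞)) by induction on tiles.  EVIDENCE (ttrl cp-mix, MIXCOMB.md §11, exact): `n = 3` exhaustive on the grids of
denominator 6–16 (all hereditary rows of orders ≤ 7, 2.2·10⁸ Bernstein coefficients), `n = 4` denominators 5–6 (orders ≤ 4, 10⁹ coefficients): 0 negative;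
every law planted outside `𝒦` fires.  The AND analogue is a THEOREM (`…SahiMixtureAnd`, and `hereditary_interEv` with a coin family).
HONEST FRAMING: H-MIX is open; nothing here claims Sahi's `C_k`. [this work]
-/

noncomputable section

open scoped Classical

namespace Summit.CriticalPhenomena.PercolationContinuityZ3.Theorems

open Finset Function
open Literature.Combinatorics.Sahi2008
open Literature.Combinatorics.Sahi2008.PartitionForm
open Literature.Probability.Percolation.DecisionTree (ind ind_of_mem ind_of_not_mem ind_nonneg)
open SahiTotalCumulance

namespace SahiMixture

/-! ### The hereditary class -/

section Defs

variable {α : Type*} [Fintype α] {μ : α → ℝ} {n : ℕ} {A : Fin n → Set α}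

/-- **The hereditary class `𝒦`**: the intersection-closed family `(⋂_{i∈K} A_i)_{K ⊆ [n]}` generated by `A` is Sahi-nonnegative at every order —
`E_m(μ; 1_{A_{K_0}},…,1_{A_{K_{m−1}}}) ≥ 0` for every `m` and every `K : Fin m → Finset (Fin n)` (Sahi–Blinovsky's monomial rows of the pattern law).
[this work] -/
def HereditaryAllOrders (μ : α → ℝ) {n : ℕ} (A : Fin n → Set α) : Prop :=
  ∀ (m : ℕ) (K : Fin m → Finset (Fin n)), 0 ≤ sahiE μ m (fun j => ind (⋂ i ∈ K j, A i))

/-- `𝒦 ⊆ K`: a hereditarily all-orders-positive family is all-orders positive (singleton intersections). [this work] -/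
theorem HereditaryAllOrders.allOrders (h : HereditaryAllOrders μ A) : AllOrders μ A := by
  intro m s
  have e : (fun j => ind (A (s j))) = fun j => ind (⋂ i ∈ ({s j} : Finset (Fin n)), A i) := by
    funext j; rw [Finset.set_biInter_singleton]
  rw [e]; exact h m (fun j => {s j})

end Defs

/-! ### Intersection stability -/

section Core

variable {α β : Type*} [Fintype α] [Fintype β] (μ : α → ℝ) (ν : β → ℝ)

omit [Fintype β] in
/-- A product of indicators is the indicator of the intersection. [folklore] -/
theorem prod_ind_eq_ind_biInter {k m : ℕ} (W : Fin m → Set β) (g : Fin k → Fin m) (y : β) :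
    ∏ j, ind (W (g j)) y = ind (⋂ i ∈ Finset.univ.image g, W i) y := by
  by_cases hy : ∀ j, y ∈ W (g j)
  · have hmem : y ∈ ⋂ i ∈ Finset.univ.image g, W i := by
      simp only [Set.mem_iInter, Finset.mem_image, Finset.mem_univ, true_and]
      rintro i ⟨j, rfl⟩; exact hy j
    rw [ind_of_mem hmem]; exact Finset.prod_eq_one fun j _ => ind_of_mem (hy j)
  · obtain ⟨j, hj⟩ := not_forall.1 hy
    have hnot : y ∉ ⋂ i ∈ Finset.univ.image g, W i := fun h =>
      hj (Set.mem_iInter₂.1 h (g j) (Finset.mem_image_of_mem g (Finset.mem_univ j)))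
    rw [ind_of_not_mem hnot]; exact Finset.prod_eq_zero (Finset.mem_univ j) (ind_of_not_mem hj)

/-- **INTERSECTION STABILITY, slot form.**  For slots `V_j × W_j` on `α × β` under the product weight: if every sub-multiset functional of `V` under `μ`
is `≥ 0` and every multiset of INTERSECTIONS of the `W_j` has nonnegative functional under `ν`, then `E_m(μ⊗ν; 1_{V_0×W_0},…,1_{V_{m−1}×W_{m−1}}) ≥ 0`.
Proof: tensor form of the law of total cumulance (`SahiTotalCumulance.sahiE_prod_tensor_eq`); every summand is a product of sub-multiset functionals of
`V` and one functional of block intersections of `W`. [this work] -/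
theorem sahiE_interEv_nonneg {m : ℕ} (V : Fin m → Set α) (W : Fin m → Set β)
    (hV : ∀ (k : ℕ) (g : Fin k → Fin m), 0 ≤ sahiE μ k (fun j => ind (V (g j))))
    (hW : ∀ (k : ℕ) (G : Fin k → Finset (Fin m)), 0 ≤ sahiE ν k (fun j => ind (⋂ i ∈ G j, W i))) :
    0 ≤ sahiE (prodWeight μ ν) m (fun j => ind (interEv (V j) (W j))) := by
  rcases m with _ | k
  · rw [sahiE_zero]
  · have hfam : (fun j => ind (interEv (V j) (W j))) = fun j (p : α × β) => ind (V j) p.1 * ind (W j) p.2 := by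
      funext j p; exact ind_interEv _ _ p
    have key : sahiE (prodWeight μ ν) (k + 1) (fun j => ind (interEv (V j) (W j))) =
        ∑ c : OrderedFinpartition (k + 1),
          (∏ b : Fin c.length, sahiE μ (block c b).card (fun j => ind (V ((block c b).orderEmbOfFin rfl j)))) *
            sahiE ν c.length (fun b y => ∏ j : Fin (block c b).card, ind (W ((block c b).orderEmbOfFin rfl j)) y) := by
      have e := sahiE_prod_tensor_eq μ ν k (fun j a => ind (V j) a) (fun j y => ind (W j) y)
      rw [hfam]
      exact e
    rw [key]
    refine Finset.sum_nonneg fun c _ => mul_nonneg (Finset.prod_nonneg fun b _ => hV _ _) ?_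
    have hblk : (fun b y => ∏ j : Fin (block c b).card, ind (W ((block c b).orderEmbOfFin rfl j)) y) =
        fun b => ind (⋂ i ∈ Finset.univ.image (fun j : Fin (block c b).card => (block c b).orderEmbOfFin rfl j), W i) := by
      funext b y; exact prod_ind_eq_ind_biInter W _ y
    rw [hblk]; exact hW _ _

variable {μ ν} {n : ℕ}

/-- **`K ∗_∩ 𝒦 ⊆ K` (every `n`)**: member-wise intersection with an INDEPENDENT, HEREDITARILY all-orders-positive family preserves all-orders Sahi
positivity — the repair of the refuted `InterClosure` (`…SahiConvolution.not_interClosure`: a second factor merely in `K` does not suffice). [this work] -/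
theorem allOrders_interEv_of_hereditary (V : Fin n → Set α) (W : Fin n → Set β) (hV : AllOrders μ V) (hW : HereditaryAllOrders ν W) :
    AllOrders (prodWeight μ ν) (fun i => interEv (V i) (W i)) := by
  intro m s
  refine sahiE_interEv_nonneg μ ν (fun j => V (s j)) (fun j => W (s j)) (fun k g => hV k (fun j => s (g j))) (fun k G => ?_)
  have e : (fun j => ind (⋂ i ∈ G j, W (s i))) = fun j => ind (⋂ l ∈ (G j).image s, W l) := by
    funext j; rw [Finset.set_biInter_finset_image]
  rw [e]; exact hW k (fun j => (G j).image s)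

/-- **`𝒦 ∗_∩ 𝒦 ⊆ 𝒦` (every `n`)**: the hereditary class is closed under member-wise intersection of independent families. [this work] -/
theorem hereditary_interEv (V : Fin n → Set α) (W : Fin n → Set β) (hV : HereditaryAllOrders μ V) (hW : HereditaryAllOrders ν W) :
    HereditaryAllOrders (prodWeight μ ν) (fun i => interEv (V i) (W i)) := by
  intro m s
  have e1 : (fun j => ind (⋂ i ∈ s j, interEv (V i) (W i))) = fun j => ind (interEv (⋂ i ∈ s j, V i) (⋂ i ∈ s j, W i)) := by
    funext j; congr 1; ext p
    simp only [interEv, Set.mem_setOf_eq, Set.mem_iInter, imp_and, forall_and]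
  rw [e1]
  refine sahiE_interEv_nonneg μ ν (fun j => ⋂ i ∈ s j, V i) (fun j => ⋂ i ∈ s j, W i) (fun k g => hV k (fun j => s (g j)))
    (fun k G => ?_)
  have e2 : (fun j => ind (⋂ l ∈ G j, ⋂ i ∈ s l, W i)) = fun j => ind (⋂ i ∈ (G j).biUnion s, W i) := by
    funext j; rw [Finset.set_biInter_biUnion]
  rw [e2]; exact hW k (fun j => (G j).biUnion s)

/-- In particular (`V` trivial): the hereditary hypothesis alone gives all orders for the `β`-family pulled back to `α × β` — and symmetrically
**`𝒦 ∗_∩ K ⊆ K`** by swapping the factors is NOT available: the first factor is only split into sub-multisets, the second is intersected. [this work] -/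
theorem allOrders_interEv_univ (W : Fin n → Set β) (hμ1 : ∑ a, μ a = 1) (hW : HereditaryAllOrders ν W) :
    AllOrders (prodWeight μ ν) (fun i => interEv (Set.univ : Set α) (W i)) := by
  refine allOrders_interEv_of_hereditary (fun _ => Set.univ) W (fun m s => ?_) hW
  have e : (fun j => ind ((fun _ : Fin n => (Set.univ : Set α)) (s j))) = fun _ => (1 : α → ℝ) := by
    funext j a; exact ind_of_mem (Set.mem_univ a)
  rw [e]
  rcases m with _ | _ | m
  · rw [sahiE_zero]
  · rw [sahiE_one_apply]
    have : ex μ ((fun _ : Fin 1 => (1 : α → ℝ)) 0) = 1 := ex_one hμ1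
    rw [this]; exact zero_le_one
  · rw [sahiE_const_one hμ1 m]

end Core

/-! ### Members of the class: log-supermodular pattern laws (Sahi–Blinovsky); a non-member: the mixture counterexample -/

/-- **Sahi–Blinovsky: every log-supermodular (FKG) pattern law is hereditary.**  On the pattern space `2^{[n]}` with an FKG probability weight, the
membership events `A_i = {C | i ∈ C}` generate the principal up-sets `{C | K ⊆ C}`, whose indicators are cumulations; `E_m ≥ 0` on cumulations is the
tree's `sahi2008_thm2_fkg`. [cite: Sahi2008, Thm. 2 (p. 211); Blinovsky2013, eq. (ee3)] -/
theorem hereditaryAllOrders_of_isFKGMeasure {n : ℕ} {μ : Finset (Fin n) → ℝ} (hμ : IsFKGMeasure μ) :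
    HereditaryAllOrders μ (fun i : Fin n => {C : Finset (Fin n) | i ∈ C}) := by
  intro m s
  refine sahi2008_thm2_fkg μ hμ _ fun j => ?_
  have e : ind (⋂ i ∈ s j, {C : Finset (Fin n) | i ∈ C}) = fun T => if s j ⊆ T then (1 : ℝ) else 0 := by
    funext T
    have hiff : T ∈ (⋂ i ∈ s j, {C : Finset (Fin n) | i ∈ C}) ↔ s j ⊆ T := by
      simp only [Set.mem_iInter, Set.mem_setOf_eq]; exact Iff.rfl
    by_cases h : s j ⊆ T
    · rw [if_pos h]; exact ind_of_mem (hiff.2 h)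
    · rw [if_neg h]; exact ind_of_not_mem (fun h' => h (hiff.1 h'))
  rw [e]; exact isCumulation_indicator_supset (s j)

section Four

variable {α : Type*} [Fintype α]

omit [Fintype α] in
/-- The rows of the ∩-closed family over the index triple `({0,1}, {2}, {3})` are the DERIVED triple `(A_0∩A_1, A_2, A_3)`. [this work] -/
theorem ind_biInter_pair_two_three (A : Fin 4 → Set α) :
    (fun j => ind (⋂ i ∈ (![({0, 1} : Finset (Fin 4)), {2}, {3}] : Fin 3 → Finset (Fin 4)) j, A i)) =
      ![ind (A 0) * ind (A 1), ind (A 2), ind (A 3)] := by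
  funext j
  fin_cases j
  · show ind (⋂ i ∈ ({0, 1} : Finset (Fin 4)), A i) = ind (A 0) * ind (A 1)
    rw [Finset.set_biInter_insert, Finset.set_biInter_singleton]
    funext x
    by_cases h0 : x ∈ A 0 <;> by_cases h1 : x ∈ A 1 <;> simp [ind_of_mem, ind_of_not_mem, h0, h1, Set.mem_inter_iff]
  · show ind (⋂ i ∈ ({2} : Finset (Fin 4)), A i) = ind (A 2)
    rw [Finset.set_biInter_singleton]
  · show ind (⋂ i ∈ ({3} : Finset (Fin 4)), A i) = ind (A 3)
    rw [Finset.set_biInter_singleton]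

/-- **The mixture counterexample is not hereditary**: ttrl cp-mix's law (`cex4Weight`, in `K_4` with all eleven rows `> 0`) has the derived row
`E_3(A_0∩A_1, A_2, A_3) = −27/2450 < 0`, so it lies outside `𝒦_4` — `𝒦_4 ⊊ K_4`. [this work; law: ttrl cp-mix] -/
theorem not_hereditaryAllOrders_cex4 : ¬ HereditaryAllOrders cex4Weight cex4Event := by
  intro h
  have h3 := h 3 ![({0, 1} : Finset (Fin 4)), {2}, {3}]
  rw [ind_biInter_pair_two_three, sahiE_three_derived_cex4] at h3
  norm_num at h3

variable {μ : α → ℝ} (hμ : ∀ a, 0 ≤ μ a) (hμ1 : ∑ a, μ a = 1) (A : Fin 4 → Set α)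
include hμ hμ1

/-- **On `𝒦_4` the fatal OR-mixture cell `(n,|F|) = (4,2)` is Bernstein-positive**: OR-ing an independent coin into `A_0, A_1` of a hereditarily
all-orders-positive quadruple keeps `E_4` Bernstein-positive of degree `4` (`…SahiMixtureHereditaryFour.bernsteinPos_four_orCoin_two_of_hereditary` with
its three rows supplied by `𝒦_4`). [this work] -/
theorem bernsteinPos_four_orCoin_two_of_hereditaryAllOrders (hA : HereditaryAllOrders μ A) :
    BernsteinPos 4 (fun h => sahiE (coinWeight μ h) 4
      ![ind (orCoin (A 0) true), ind (orCoin (A 1) true), ind (orCoin (A 2) false), ind (orCoin (A 3) false)]) := by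
  have hall : AllOrders μ A := hA.allOrders
  have hE4 : 0 ≤ sahiE μ 4 ![ind (A 0), ind (A 1), ind (A 2), ind (A 3)] := by
    have e : (fun j : Fin 4 => ind (A (id j))) = ![ind (A 0), ind (A 1), ind (A 2), ind (A 3)] :=
      funext fun j => by fin_cases j <;> rfl
    rw [← e]; exact hall 4 id
  have hE3d : 0 ≤ sahiE μ 3 ![ind (A 0) * ind (A 1), ind (A 2), ind (A 3)] := by
    rw [← ind_biInter_pair_two_three]; exact hA 3 _
  have hC23 : ex μ (ind (A 2)) * ex μ (ind (A 3)) ≤ ex μ (ind (A 2) * ind (A 3)) := by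
    have h2 := hall 2 ![2, 3]
    rw [sahiE_two_apply] at h2
    simp only [Matrix.cons_val_zero, Matrix.cons_val_one] at h2
    linarith
  exact bernsteinPos_four_orCoin_two_of_hereditary hμ hμ1 (A 0) (A 1) (A 2) (A 3) hE4 hE3d hC23

end Four

/-! ### The AND half of the hereditary mixture statement is a theorem -/

section AndHereditary

variable {α : Type*} [Fintype α] {μ : α → ℝ} {n : ℕ} (A : Fin n → Set α) (F : Fin n → Bool)

omit [Fintype α] in
/-- Intersections of AND-mixed events are AND-mixed intersections: `⋂_{i∈K} (A_i ∩ ([F i] → H)) = (⋂_{i∈K} A_i) ∩ ([∃ i ∈ K, F i] → H)`. [this work] -/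
theorem biInter_andCoin (K : Finset (Fin n)) :
    (⋂ i ∈ K, andCoin (A i) (F i)) = andCoin (⋂ i ∈ K, A i) (decide (∃ i ∈ K, F i = true)) := by
  ext x
  simp only [andCoin, Set.mem_setOf_eq, Set.mem_iInter, decide_eq_true_eq]
  exact ⟨fun h => ⟨fun i hi => (h i hi).1, fun ⟨i, hi, hF⟩ => (h i hi).2 hF⟩,
    fun ⟨h1, h2⟩ i hi => ⟨h1 i hi, fun hF => h2 ⟨i, hi, hF⟩⟩⟩

/-- **H-MIX, AND half: THEOREM (every `n`).**  If `A` is hereditarily all-orders positive, every row of the intersection-closed family of the AND-mixed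
events `A_i ∩ ([F i] → H)` is Bernstein-positive of its degree in the bias (so `𝒦` is preserved under AND-mixing).  The ∩-closed family of `A`,
re-indexed by `Fin (2^n)`, is an all-orders-positive family to which `…SahiMixtureAnd.andMixture_bernsteinPos` applies. [this work] -/
theorem hereditary_andCoin_bernsteinPos (hA : HereditaryAllOrders μ A) (m : ℕ) (K : Fin m → Finset (Fin n)) :
    BernsteinPos m (fun h => sahiE (coinWeight μ h) m (fun j => ind (⋂ i ∈ K j, andCoin (A i) (F i)))) := by
  -- re-index the ∩-closed family by `Fin N`
  set e : Finset (Fin n) ≃ Fin (Fintype.card (Finset (Fin n))) := Fintype.equivFin _ with he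
  set A' : Fin (Fintype.card (Finset (Fin n))) → Set α := fun k => ⋂ i ∈ e.symm k, A i with hA'
  set F' : Fin (Fintype.card (Finset (Fin n))) → Bool := fun k => decide (∃ i ∈ e.symm k, F i = true) with hF'
  have hall : AllOrders μ A' := fun m' s => hA m' (fun j => e.symm (s j))
  have key := andMixture_bernsteinPos A' F' hall m (fun j => e (K j))
  refine key.congr fun h _ _ => ?_
  congr 1
  funext j
  rw [biInter_andCoin]
  simp only [hA', hF', Equiv.symm_apply_apply]

/-- Hence AND-mixing maps `𝒦` to `𝒦` for every bias `h ∈ [0,1]`. [this work] -/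
theorem hereditaryAllOrders_andCoin (hA : HereditaryAllOrders μ A) {h : ℝ} (h0 : 0 ≤ h) (h1 : h ≤ 1) :
    HereditaryAllOrders (coinWeight μ h) (fun i => andCoin (A i) (F i)) :=
  fun m K => (hereditary_andCoin_bernsteinPos A F hA m K).nonneg h0 h1

end AndHereditary

/-! ### The hereditary mixture conjecture -/

/-- **THE HEREDITARY MIXTURE CONJECTURE (H-MIX)** (this seat, gen 5–6; HIERARCHY.md §12(k), §13; replaces the refuted `MixtureBernsteinPositivity`):
for every probability weight `μ` on a finite type, every family `A_0,…,A_{n−1}` in the hereditary class `𝒦` (`HereditaryAllOrders μ A`), every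
`F : Fin n → Bool` and every multiset `K : Fin m → Finset (Fin n)` of index sets, the functional of the INTERSECTION-CLOSED family of the OR-mixed events,
`h ↦ E_m(μ ⊗ coin(h); (1_{⋂_{i∈K_j} (A_i ∪ [F i]·H)})_j)` (members `B_K = A_K ∪ (H ∩ A_{K∖F})`), is Bernstein-positive of degree `m` — so `𝒦` is preserved
under OR-mixing.  H-MIX ⇒ all-orders Sahi positivity of every finite Boolean model (induction on tiles from the empty model).  EVIDENCE (ttrl cp-mix
MIXCOMB.md §11, exact exhaustive censuses): `n = 3`, denominators ≤ 16, all hereditary rows of orders ≤ 7: 0 negative Bernstein coefficients in 2.2·10⁸;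
`n = 4`, denominators 5, 6, orders ≤ 4: 0 negative in 10⁹; every planted non-member fires.  The AND analogue is a theorem (`…SahiMixtureAnd`,
`hereditary_interEv`).  OPEN; an obligation of our theories, never a fact: use as `(h : HereditaryMixturePositivity)`. [status: open] -/
@[conjecture] def HereditaryMixturePositivity : Prop :=
  ∀ (α : Type) [Fintype α] (μ : α → ℝ), (∀ a, 0 ≤ μ a) → ∑ a, μ a = 1 →
    ∀ (n : ℕ) (A : Fin n → Set α) (F : Fin n → Bool), HereditaryAllOrders μ A →
      ∀ (m : ℕ) (K : Fin m → Finset (Fin n)),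
        BernsteinPos m (fun h => sahiE (coinWeight μ h) m (fun j => ind (⋂ i ∈ K j, orCoin (A i) (F i))))

/-- H-MIX contains the statement that OR-mixing maps `𝒦` to `𝒦` (every bias `h ∈ [0,1]`). [this work] -/
theorem hereditaryAllOrders_orCoin_of_HMIX (hmix : HereditaryMixturePositivity) {α : Type} [Fintype α] {μ : α → ℝ} (hμ : ∀ a, 0 ≤ μ a)
    (hμ1 : ∑ a, μ a = 1) {n : ℕ} (A : Fin n → Set α) (F : Fin n → Bool) (hA : HereditaryAllOrders μ A) {h : ℝ} (h0 : 0 ≤ h) (h1 : h ≤ 1) :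
    HereditaryAllOrders (coinWeight μ h) (fun i => orCoin (A i) (F i)) :=
  fun m K => (hmix α μ hμ hμ1 n A F hA m K).nonneg h0 h1

end SahiMixture

end Summit.CriticalPhenomena.PercolationContinuityZ3.Theorems

end
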